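import Summits.Ventures.PercRepro.RankLevelSetRuleQCellOne

/-!
# PercRepro — `m̂` AS A SINGLE SUM OVER THE FREE-PART TRACE (night-1, gen 14; step 4 of `ModelRecvEq`)

`m̂(q, m; a, j) = Σ_{t_P ≤ a} Σ_{t_D ≤ min(j, q−m)} C(q, t_P + t_D)·C(a, t_P)·C(j, t_D)` collapses by Vandermonde over `t_P` to
`Σ_{t ≤ min(j, q−m)} C(j, t)·C(q + a, q − t)`, and this equals the member count `Σ_{i ∈ Icc m q} C(q + a, i)·C(j, q − i)` of
RankLevelSetRuleQModelCount (`i = q − t`; the terms with `t > j` vanish).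
* `sum_choose_add_mul_choose_eq` — `Σ_{t_P ≤ a} C(q, t_P + t_D)·C(a, t_P) = C(q + a, q − t_D)` for `t_D ≤ q`;
* `mhat_eq_sum_trace` — `m̂(q, m; a, j) = Σ_{t ∈ range (min j (q−m) + 1)} C(j, t)·C(q + a, q − t)` for `m ≤ q`;
* **`sum_Icc_choose_eq_mhat`** — `Σ_{i ∈ Icc m q} C(q + a, i)·C(j, q − i) = m̂(q, m; a, j)` for `m ≤ q`.
Axioms: standard.
-/

namespace PercRepro

open Finset

/-- A sum of `f` over `range (n + 1)` equals the sum over `range (N + 1)` when `f` vanishes above `n` (`n ≤ N`). -/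
lemma sum_range_succ_eq_of_vanish (f : ℕ → ℕ) {n N : ℕ} (hnN : n ≤ N) (hf : ∀ t, n < t → t ≤ N → f t = 0) :
    (∑ t ∈ Finset.range (n + 1), f t) = ∑ t ∈ Finset.range (N + 1), f t := by
  apply Finset.sum_subset
  · intro t ht
    rw [Finset.mem_range] at ht ⊢
    omega
  · intro t ht hnot
    rw [Finset.mem_range] at ht hnot
    exact hf t (by omega) (by omega)

/-- Vandermonde with a shift: `Σ_{t_P ≤ a} C(q, t_P + t_D)·C(a, t_P) = C(q + a, q − t_D)` for `t_D ≤ q`. -/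
lemma sum_choose_add_mul_choose_eq (q a tD : ℕ) (htD : tD ≤ q) :
    (∑ tP ∈ Finset.range (a + 1), q.choose (tP + tD) * a.choose tP) = (q + a).choose (q - tD) := by
  set f : ℕ → ℕ := fun tP => q.choose (tP + tD) * a.choose tP with hf
  have hvan : ∀ tP, (a < tP ∨ q - tD < tP) → f tP = 0 := by
    intro tP h
    simp only [hf]
    rcases h with h | h
    · rw [Nat.choose_eq_zero_of_lt h, mul_zero]
    · rw [Nat.choose_eq_zero_of_lt (by omega : q < tP + tD), zero_mul]
  -- Vandermonde: C(q + a, q − tD) = Σ_{k ≤ q − tD} C(q, k)·C(a, q − tD − k), reflected to Σ_{tP ≤ q − tD} f tP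
  have hV : (q + a).choose (q - tD) = ∑ tP ∈ Finset.range (q - tD + 1), f tP := by
    rw [Nat.add_choose_eq q a (q - tD),
      Finset.Nat.sum_antidiagonal_eq_sum_range_succ (fun i i' => q.choose i * a.choose i'), Nat.succ_eq_add_one]
    rw [← Finset.sum_range_reflect]
    apply Finset.sum_congr rfl
    intro tP htP
    rw [Finset.mem_range] at htP
    simp only [hf]
    rw [show q - tD + 1 - 1 - tP = q - (tP + tD) by omega, show q - tD - (q - (tP + tD)) = tP by omega,
      Nat.choose_symm (by omega)]
  rw [hV, sum_range_succ_eq_of_vanish f (le_max_left a (q - tD)) (fun t ht _ => hvan t (Or.inl ht)),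
    sum_range_succ_eq_of_vanish f (le_max_right a (q - tD)) (fun t ht _ => hvan t (Or.inr ht))]

/-- `m̂(q, m; a, j)` as a single sum over the free-part trace `t`: `Σ_{t ≤ min(j, q − m)} C(j, t)·C(q + a, q − t)`. -/
lemma mhat_eq_sum_trace (q m a j : ℕ) (hm : m ≤ q) :
    mhat q m a j = ∑ t ∈ Finset.range (min j (q - m) + 1), j.choose t * (q + a).choose (q - t) := by
  unfold mhat
  rw [Finset.sum_comm]
  apply Finset.sum_congr rfl
  intro t ht
  rw [Finset.mem_range] at ht
  have htq : t ≤ q := by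
    have := min_le_right j (q - m)
    omega
  rw [← sum_choose_add_mul_choose_eq q a t htq, Finset.mul_sum]
  apply Finset.sum_congr rfl
  intro tP _
  ring

/-- **The member count is `m̂`**: `Σ_{i ∈ Icc m q} C(q + a, i)·C(j, q − i) = m̂(q, m; a, j)` for `m ≤ q` (substitute `i = q − t`;
the terms with `t > j` vanish). -/
theorem sum_Icc_choose_eq_mhat (q m a j : ℕ) (hm : m ≤ q) :
    (∑ i ∈ Finset.Icc m q, (q + a).choose i * j.choose (q - i)) = mhat q m a j := by
  rw [mhat_eq_sum_trace q m a j hm]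
  -- reindex the left sum by t = q − i over range (q − m + 1)
  have hL : (∑ i ∈ Finset.Icc m q, (q + a).choose i * j.choose (q - i))
      = ∑ t ∈ Finset.range (q - m + 1), j.choose t * (q + a).choose (q - t) := by
    rw [← Finset.Ico_succ_right_eq_Icc, Order.succ_eq_add_one, Finset.sum_Ico_eq_sum_range,
      show q + 1 - m = q - m + 1 by omega, ← Finset.sum_range_reflect]
    apply Finset.sum_congr rfl
    intro t ht
    rw [Finset.mem_range] at ht
    rw [show q - m + 1 - 1 - t = q - m - t by omega, show q - (m + (q - m - t)) = t by omega,
      show m + (q - m - t) = q - t by omega, mul_comm]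
  rw [hL]
  symm
  apply sum_range_succ_eq_of_vanish (fun t => j.choose t * (q + a).choose (q - t)) (min_le_right j (q - m))
  intro t ht htN
  have hjt : j < t := by
    rcases le_total j (q - m) with h | h
    · rw [min_eq_left h] at ht
      exact ht
    · rw [min_eq_right h] at ht
      omega
  show j.choose t * (q + a).choose (q - t) = 0
  rw [Nat.choose_eq_zero_of_lt hjt, zero_mul]

end PercRepro
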